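import Summits.CriticalPhenomena.SAWScalingLimit.Theses.SAWTotalPositivity
import Summits.CriticalPhenomena.SAWScalingLimit.Theorems.SAWTotalPositivityBoundaryTP2Defs
import Summits.CriticalPhenomena.SAWScalingLimit.Theorems.SAWTotalPositivityBoundaryTP2Kernel
import Summits.CriticalPhenomena.SAWScalingLimit.Theorems.SAWTotalPositivityBoundaryTP2Continuity
import Summits.CriticalPhenomena.SAWScalingLimit.Theorems.SAWLeftRightFKGLeftRightFKGThreePointDefs
import HarnessLib

/-!
# Strategist sketch — crux `BoundaryTP2` (stmt-CriticalPhenomena-7115): typed signatures for STRATEGY-CENSUS.md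

Every statement named in the census under Strengthen / Decomposition / Weaken is typed here over the landed
vocabulary (`BoundaryTP2.{pathKernel, Interlaced, DisjointPaths, GraphTP2At, InterlacedTP2At}`,
`LeftRightFKG.ThreePoint.ThreePointAt`) so that the census points at elaborated Props, and the two
implications that ARE provable now are proved (`boundaryTP2_of_subcritical`, `tp2_of_split`).
Nothing here is registered as a line: see STRATEGY-CENSUS.md for why each switch has no teeth.
-/

noncomputable section

namespace Summit.CriticalPhenomena.SAWScalingLimit.Cruxes.BoundaryTP2.Strategist

open Literature.Probability.LatticeModels Literature.Probability.RandomPlanarGeometry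
open Summit.CriticalPhenomena.SAWScalingLimit.Theorems.BoundaryTP2
open Summit.CriticalPhenomena.SAWScalingLimit.Theorems.LeftRightFKG.ThreePoint (ThreePointAt)
open scoped ENNReal

/-! ## Strengthen -/

/-- S⁺₇ (census §Strengthen): the SUBCRITICAL core — TP₂ at every `0 < x < x_c`. Equivalent in difficulty to
the core (continuity gives `x_c`; conversely nothing, but no subcritical instance is known to fail). -/
def SubcriticalGraphTP2 : Prop :=
  ∀ x : ℝ, 0 < x → x < SAW.criticalFugacity → GraphTP2At x

/-- The subcritical strengthening concludes the crux BY NAME (landed continuity + landed transfer). -/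
theorem boundaryTP2_of_subcritical (h : SubcriticalGraphTP2) :
    Summit.CriticalPhenomena.SAWScalingLimit.Theses.SAWTotalPositivity.BoundaryTP2 :=
  boundaryTP2_of_graphTP2At (graphTP2At_criticalFugacity_of_subcritical h)

/-- S⁺₁ (carrier): interlacing-only TP₂ at `x_c` — by the landed structure theorem it is EXACTLY
`GraphTP2At x_c ∧ ThreePointAt x_c` (11232 lead c2), so it is the core plus a second open statement. -/
def CarrierAtXc : Prop := InterlacedTP2At SAW.criticalFugacity

theorem carrier_iff : CarrierAtXc ↔ GraphTP2At SAW.criticalFugacity ∧ ThreePointAt SAW.criticalFugacity :=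
  Summit.CriticalPhenomena.SAWScalingLimit.Theorems.LeftRightFKG.ThreePoint.interlacedTP2At_iff
    SAW.criticalFugacity_pos

/-! ## Decomposition -/

/-- D₄ piece 1 (census §Decomposition): the TWO-EDGE core at fugacity `x` — TP₂ for interlaced quadruples whose
source pair `{p₄,p₁}` and target pair `{p₂,p₃}` are EDGES of `H` (the mixed-second-difference / clustered-pairs
regime; numerically the regime of the smallest margins: slit-tip plaquette 1.1e-3, opposite corners `∝ L^{-3.5}`). -/
def TwoEdgeTP2At (x : ℝ) : Prop :=
  ∀ H : SimpleGraph (Site 2), H ≤ zdGraph 2 → H.support.Finite →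
    ∀ p₁ p₂ p₃ p₄ : Site 2, H.Adj p₄ p₁ → H.Adj p₂ p₃ → p₁ ≠ p₂ → p₃ ≠ p₄ →
      Interlaced H p₁ p₂ p₃ p₄ →
        pathKernel H x p₁ p₃ * pathKernel H x p₂ p₄ ≤ pathKernel H x p₁ p₂ * pathKernel H x p₃ p₄

/-- D₄ glue (census §Decomposition): Fekete ratio-chaining along the outer face + Menger/cut-vertex factorisation —
fugacity-uniform, the registered `stub_twoEdgeReduction` of line `renewal-cauchy-binet-kesten-budget` up to carriers. -/
def TwoEdgeReduction (x : ℝ) : Prop :=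
  TwoEdgeTP2At x → ThreePointAt x → GraphTP2At x

/-- The typed split `TwoEdgeTP2At x_c → ThreePointAt x_c → TwoEdgeReduction x_c → BoundaryTP2` (trivial assembly;
piece 1 remains the whole crux, see census). -/
theorem boundaryTP2_of_twoEdge_split (h₁ : TwoEdgeTP2At SAW.criticalFugacity)
    (h₂ : ThreePointAt SAW.criticalFugacity) (hglue : TwoEdgeReduction SAW.criticalFugacity) :
    Summit.CriticalPhenomena.SAWScalingLimit.Theses.SAWTotalPositivity.BoundaryTP2 :=
  boundaryTP2_of_graphTP2At (hglue h₁ h₂)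

/-- Pair sums over two path spaces restricted by a relation `R` (disjoint / intersecting pairs). -/
def pairKernel {V : Type*} (H : SimpleGraph V) (x : ℝ) {a b c d : V}
    (R : H.Path a b → H.Path c d → Prop) : ℝ≥0∞ :=
  ∑' pq : H.Path a b × H.Path c d,
    {pq | R pq.1 pq.2}.indicator (fun pq => ENNReal.ofReal (x ^ (pq.1.1.length + pq.2.1.length))) pq

/-- Disjoint pairs realising the pairing `(a b | c d)`. -/
def disjointKernel {V : Type*} (H : SimpleGraph V) (x : ℝ) (a b c d : V) : ℝ≥0∞ :=
  pairKernel H x (fun (P : H.Path a b) (Q : H.Path c d) => List.Disjoint P.1.support Q.1.support)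

/-- Intersecting pairs realising the pairing `(a b | c d)`. -/
def meetingKernel {V : Type*} (H : SimpleGraph V) (x : ℝ) (a b c d : V) : ℝ≥0∞ :=
  pairKernel H x (fun (P : H.Path a b) (Q : H.Path c d) => ¬ List.Disjoint P.1.support Q.1.support)

/-- D₅ piece P1 (census §Decomposition, the n → 0 shadow of GKS-II in the Ising mechanism GBK + GKS):
"disjoint `(12|34)`-pairs outweigh intersecting `(14|23)`-pairs". **FALSE at `x_c`** on the `8×2` and `12×2`
ladders (corner quadruple; exact enumeration exp/split.c: relative margins −7.4e-3, −1.8e-3), recorded so that no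
seat re-files the Ising-shaped split. -/
def DisjointBeatsMeeting (x : ℝ) : Prop :=
  ∀ H : SimpleGraph (Site 2), H ≤ zdGraph 2 → H.support.Finite →
    ∀ p₁ p₂ p₃ p₄ : Site 2, Interlaced H p₁ p₂ p₃ p₄ → DisjointPaths H p₁ p₂ p₃ p₄ → DisjointPaths H p₁ p₄ p₂ p₃ →
      meetingKernel H x p₁ p₄ p₂ p₃ ≤ disjointKernel H x p₁ p₂ p₃ p₄

/-- D₅ piece P2 ("Pfaffian defect ≥ 0"): crossing pairs weigh at most the INTERSECTING nested pairs of both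
nestings together. Numerically alive (relative margin 0.13–0.17 on squares ≤ 5×5, → 0⁺ on ladders: 2.0e-3 at
12×2) and carries a near-mechanism (the two tail switches at the first meeting vertex; only doubly-bad pairs —
15.7 % of C on 12×2 — escape both), but useless for the crux once P1 is false. -/
def MeetingNestedBeatCrossing (x : ℝ) : Prop :=
  ∀ H : SimpleGraph (Site 2), H ≤ zdGraph 2 → H.support.Finite →
    ∀ p₁ p₂ p₃ p₄ : Site 2, Interlaced H p₁ p₂ p₃ p₄ → DisjointPaths H p₁ p₂ p₃ p₄ → DisjointPaths H p₁ p₄ p₂ p₃ →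
      pathKernel H x p₁ p₃ * pathKernel H x p₂ p₄ ≤
        meetingKernel H x p₁ p₂ p₃ p₄ + meetingKernel H x p₁ p₄ p₂ p₃

/-! ## Weaken (tenure-level remark, not a line: a weakening cannot conclude the crux) -/

/-- Quasi-TP₂ with constant `K` at fugacity `x`: `Z₁₃Z₂₄ ≤ K · Z₁₂Z₃₄`. For `K < 1/x²` the square gadget still
gives a uniform two-point bound, so the statement stays `x_c`-sharp; it has no vanishing-margin regime if TP₂ is
true. Census §Strengthen/Weaken explains why even this is out of reach of the known multivalent maps
(peeling multiplicity grows linearly along ladders: 0.43 → 1.72 for 2×L, L = 3…12). -/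
def QuasiTP2At (K : ℝ≥0∞) (x : ℝ) : Prop :=
  ∀ H : SimpleGraph (Site 2), H ≤ zdGraph 2 → H.support.Finite →
    ∀ p₁ p₂ p₃ p₄ : Site 2, Interlaced H p₁ p₂ p₃ p₄ →
      DisjointPaths H p₁ p₂ p₃ p₄ → DisjointPaths H p₁ p₄ p₂ p₃ →
        pathKernel H x p₁ p₃ * pathKernel H x p₂ p₄ ≤ K * (pathKernel H x p₁ p₂ * pathKernel H x p₃ p₄)

theorem quasiTP2At_one_iff (x : ℝ) : QuasiTP2At 1 x ↔ GraphTP2At x := by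
  simp only [QuasiTP2At, GraphTP2At, one_mul]

end Summit.CriticalPhenomena.SAWScalingLimit.Cruxes.BoundaryTP2.Strategist
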